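import Summits.HubbardSuperconductivity.HubbardSuperconductivity.Theorems.NoGoNogoSingletPairKillsSaturatedFM
import Literature.MathematicalPhysics.QuantumLattice.PairFieldCarrierBound
import Literature.MathematicalPhysics.QuantumLattice.PairChirality

/-!
# Crux `BirGroundStateAverageLRO` (item `stmt-HubbardSuperconductivity-2079`), spin corner I: no singlet pair amplitude without down electrons

First of three files establishing the SPIN CEILING on the crux's order functional (route BalabanIR,
target `Theses.BalabanIR.BirGroundStateAverageLRO`; regime map of `Negative/RegimeMap.lean`): the
qualitative fact "a singlet pair field annihilates a saturated ferromagnet" (route NoGo crux 5,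
`NoGo.pairField_mulVec_eq_zero_of_saturated`; the disprover's §6) made QUANTITATIVE. This file is the
elementary input, for Scalapino's pair field `Δ_g = Σ_x P_x` on the fermionic torus `(ℤ/Lℤ)²`
(`PairCorrelations.pairField`) and the spin sectors `(N↑, N↓) = (a, b)` (`HubbardLiebConfig.IsInSector`):

* `sum_numberOp_one_mulVec_of_isInSector`, `sum_norm_sq_annihilation_down_of_isInSector` —
  `N↓ = b` on the sector, `Σ_x ‖c_{x↓} ψ‖² = b ‖ψ‖²`;
* `isInSector_mulVec_of_shifts`, `shifts_pairField`, `isInSector_pairField_mulVec` — `Δ_g` has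
  grade `(-1,-1)`: it maps the sector `(a+1, b+1)` to `(a, b)` (tree: `PairChirality.shifts_localPair`;
  that it commutes with `S⁺` is `PairChirality.spin_commute_localPair`, used in the ladder file);
* `norm_toLp_pairTerm_mulVec_le` — each elementary term `c_{(x,κ)} c_{(y,κ̄)}` is dominated by the
  annihilator of its DOWN orbital; `sum_family_downSiteWeight` — the down sites of the family
  `j = (x, e, κ)` cover every site `10` times;
* `norm_sq_pairField_mulVec_le_of_isInSector` — **`‖Δ_g ψ‖² ≤ 10 L² (Σ_e g(e)²) · b · ‖ψ‖²` on the
  sector `(a, b)`** (family decomposition `PairFieldCarrier.pairField_mulVec_apply_eq_sum`, triangle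
  inequality, contraction, Cauchy–Schwarz, `PairFieldCarrier.sum_norm_sq_weight`); the `d`-wave case
  `norm_sq_pairField_dWave_mulVec_le_of_isInSector`: `‖Δ_d ψ‖² ≤ 40 L² · N↓ · ‖ψ‖²`;
* `re_star_dotProduct_spinSq_mulVec_nonneg`, `eq_zero_of_spinSq_mulVec_of_neg` — `S² ≥ 0` (an
  `S²`-eigenvector with negative eigenvalue vanishes), for the ladder of `SpinCeilingLadder.lean`.

The `su(2)` ladder turning "few down electrons" into "total spin close to `N/2`" is in
`SpinCeilingLadder.lean`; the crux format in `SpinCeiling.lean`.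

Sources: D. J. Scalapino, Phys. Rep. 250 (1995) 329, §2 (pair field); H. Tasaki, Prog. Theor. Phys. 99
(1998) 489, p. 20 (operators containing `c_{·↓}` versus ferromagnets); H. Tasaki, *Physics and
Mathematics of Quantum Many-Body Systems* (2020) §9.3; E. H. Lieb, PRL 62 (1989) 1201, eq. (2)
(sectors). Folklore finite-dimensional statements; no definition and no named fact is introduced;
nothing here asserts a Theses decl.
-/

noncomputable section

namespace Summit.HubbardSuperconductivity.HubbardSuperconductivity.Theorems.BirGroundStateAverageLRO.Negative

set_option linter.dupNamespace false

open Matrix Finset Filter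
open Literature.Probability.LatticeModels Literature.MathematicalPhysics.QuantumLattice
open Summit.HubbardSuperconductivity.HubbardSuperconductivity.Theorems
open scoped ComplexOrder

/-! ### Sector bookkeeping: the number of down electrons, and the grade `(-1,-1)` of the pair field -/

section Sector

variable {Λ : Type*} [LinearOrder Λ] [Fintype Λ]

/-- `N↓ = Σ_x n_{x↓}` acts on the sector `(a, b)` as the number `b`. Lieb, PRL 62 (1989) 1201,
eq. (2). [folklore] -/
theorem sum_numberOp_one_mulVec_of_isInSector {a b : ℕ} {ψ : Fock (Orb Λ)} (hψ : IsInSector a b ψ) :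
    (∑ x : Λ, numberOp x 1 : Matrix (Finset (Orb Λ)) (Finset (Orb Λ)) ℂ) *ᵥ ψ = (b : ℂ) • ψ := by
  have hdiag : (∑ x : Λ, numberOp x 1 : Matrix (Finset (Orb Λ)) (Finset (Orb Λ)) ℂ) =
      diagonal fun s => ((downPart s).card : ℂ) := by
    ext s t
    simp only [Matrix.sum_apply, LiebThm1.numberOp_eq_diagonal, diagonal_apply]
    by_cases h : s = t
    · subst h
      simp only [if_true]
      rw [Finset.sum_boole]
      rfl
    · simp [h]
  funext s
  rw [hdiag, mulVec_diagonal, Pi.smul_apply, smul_eq_mul]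
  by_cases hs : (upPart s).card = a ∧ (downPart s).card = b
  · rw [hs.2]
  · rw [hψ s hs, mul_zero, mul_zero]

/-- `Σ_x ‖c_{x↓} ψ‖² = b ‖ψ‖²` on the sector `(a, b)` (`c†_{x↓} c_{x↓} = n_{x↓}` and `N↓ = b`).
Lieb, PRL 62 (1989) 1201, eq. (2). [folklore] -/
theorem sum_norm_sq_annihilation_down_of_isInSector {a b : ℕ} {ψ : Fock (Orb Λ)}
    (hψ : IsInSector a b ψ) :
    ∑ x : Λ, ‖(WithLp.toLp 2 (annihilation (orb x 1) *ᵥ ψ) : EuclideanSpace ℂ (Finset (Orb Λ)))‖ ^ 2 =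
      (b : ℝ) * (star ψ ⬝ᵥ ψ).re := by
  have hterm : ∀ x : Λ,
      ‖(WithLp.toLp 2 (annihilation (orb x 1) *ᵥ ψ) : EuclideanSpace ℂ (Finset (Orb Λ)))‖ ^ 2 =
        (star ψ ⬝ᵥ ((numberOp x 1 : Matrix (Finset (Orb Λ)) (Finset (Orb Λ)) ℂ) *ᵥ ψ)).re := by
    intro x
    rw [norm_toLp_sq_eq_re, ← LiebThm1.star_dotProduct_conjTranspose_mul_mulVec,
      annihilation_conjTranspose]
    rfl
  simp only [hterm]
  rw [← Complex.re_sum, ← dotProduct_sum, ← Matrix.sum_mulVec,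
    sum_numberOp_one_mulVec_of_isInSector hψ, dotProduct_smul, smul_eq_mul,
    show ((b : ℕ) : ℂ) = ((b : ℝ) : ℂ) by norm_cast, Complex.re_ofReal_mul]

/-- A matrix of grade `(-1, -1)` (one up and one down electron removed, e.g. a singlet pair
annihilator) maps the sector `(a + 1, b + 1)` to the sector `(a, b)`. Tasaki (2020) §9.3. [folklore] -/
theorem isInSector_mulVec_of_shifts {M : Matrix (Finset (Orb Λ)) (Finset (Orb Λ)) ℂ}
    (hM : PairChirality.Shifts (-1) (-1) M) {a b : ℕ} {ψ : Fock (Orb Λ)}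
    (hψ : IsInSector (a + 1) (b + 1) ψ) : IsInSector a b (M *ᵥ ψ) := by
  intro s hs
  rw [mulVec, dotProduct]
  refine Finset.sum_eq_zero fun t _ => ?_
  by_cases hMs : M s t = 0
  · rw [hMs, zero_mul]
  · by_cases ht : (upPart t).card = a + 1 ∧ (downPart t).card = b + 1
    · exfalso
      have h := hM s t hMs
      refine hs ⟨?_, ?_⟩
      · have h1 := h.1
        rw [ht.1] at h1
        push_cast at h1
        exact_mod_cast (by linarith : ((upPart s).card : ℤ) = a)
      · have h2 := h.2
        rw [ht.2] at h2
        push_cast at h2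
        exact_mod_cast (by linarith : ((downPart s).card : ℤ) = b)
    · rw [hψ t ht, mul_zero]

end Sector

/-! ### The pair field is graded `(-1,-1)` -/

section PairFieldAlgebra

variable (g : Site 2 → ℝ) (L : ℕ) [NeZero L]

/-- `Δ_g` has grade `(-1, -1)`. Tasaki (2020) §9.3. [folklore] -/
theorem shifts_pairField : PairChirality.Shifts (-1) (-1) (pairField g L) := by
  rw [pairField]
  exact PairChirality.Shifts.sum fun x _ => PairChirality.shifts_localPair L g x

/-- `Δ_g` maps the sector `(a + 1, b + 1)` to `(a, b)`. Tasaki (2020) §9.3. [folklore] -/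
theorem isInSector_pairField_mulVec {a b : ℕ} {ψ : Fock (Orb (FermionTorus 2 L))}
    (hψ : IsInSector (a + 1) (b + 1) ψ) : IsInSector a b (pairField g L *ᵥ ψ) :=
  isInSector_mulVec_of_shifts (shifts_pairField g L) hψ

end PairFieldAlgebra


/-! ### No singlet pair amplitude without down electrons: `‖Δ_g ψ‖² ≤ 10 L² ‖g‖² · N↓ · ‖ψ‖²` -/

section DownBound

variable (g : Site 2 → ℝ) (L : ℕ) [NeZero L]

/-- Each elementary term `c_{(x,κ)} c_{(y,κ̄)}` of the pair field is dominated by the annihilator of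
its DOWN orbital: `‖c_{(x,κ)} c_{(y,κ̄)} ψ‖ ≤ ‖c_{down} ψ‖` (`c`'s are contractions and anticommute).
Bratteli–Robinson II §5.2.2. [folklore] -/
theorem norm_toLp_pairTerm_mulVec_le (x y : TorusSite 2 L) (κ : Fin 2)
    (ψ : Fock (Orb (FermionTorus 2 L))) :
    ‖(WithLp.toLp 2 ((annihilation (orb (FermionTorus.ofTorusSite x) κ) *
        annihilation (orb (FermionTorus.ofTorusSite y) (1 - κ))) *ᵥ ψ) :
        EuclideanSpace ℂ (Finset (Orb (FermionTorus 2 L))))‖ ≤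
      ‖(WithLp.toLp 2 (annihilation (orb (FermionTorus.ofTorusSite (if κ = 0 then y else x)) 1) *ᵥ ψ) :
        EuclideanSpace ℂ (Finset (Orb (FermionTorus 2 L))))‖ := by
  fin_cases κ
  · simp only [Fin.zero_eta, Fin.isValue, sub_zero, if_true]
    rw [← mulVec_mulVec]
    exact norm_toLp_annihilation_mulVec_le _ _
  · simp only [Fin.mk_one, Fin.isValue, sub_self, one_ne_zero, if_false]
    have h := annihilation_anticommute_holds (ι := Orb (FermionTorus 2 L))
      (orb (FermionTorus.ofTorusSite x) 1) (orb (FermionTorus.ofTorusSite y) 0)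
    rw [eq_neg_of_add_eq_zero_left h, Matrix.neg_mulVec, WithLp.toLp_neg, norm_neg, ← mulVec_mulVec]
    exact norm_toLp_annihilation_mulVec_le _ _

/-- A site weight evaluated at the DOWN site of each member of the family `j = (x, e, κ)` (the site
`x + e` for `κ = ↑`, the site `x` for `κ = ↓`) is counted `10` times. [folklore] -/
theorem sum_family_downSiteWeight (F : TorusSite 2 L → ℝ) :
    ∑ j : TorusSite 2 L × ↥(insert (0 : Site 2) unitSteps) × Fin 2,
        F (if j.2.2 = 0 then j.1 + Torus.proj L (j.2.1 : Site 2) else j.1) =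
      10 * ∑ x : TorusSite 2 L, F x := by
  have h5 : (Finset.univ : Finset ↥(insert (0 : Site 2) unitSteps)).card = 5 := by
    rw [Finset.card_univ, Fintype.card_coe, PairFieldCarrier.card_insert_zero_unitSteps]
  have hA : ∑ x : TorusSite 2 L, ∑ e : ↥(insert (0 : Site 2) unitSteps),
      F (x + Torus.proj L (e : Site 2)) = 5 * ∑ x : TorusSite 2 L, F x := by
    rw [Finset.sum_comm]
    have hinner : ∀ e : ↥(insert (0 : Site 2) unitSteps),
        ∑ x : TorusSite 2 L, F (x + Torus.proj L (e : Site 2)) = ∑ x : TorusSite 2 L, F x :=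
      fun e => Equiv.sum_comp (Equiv.addRight (Torus.proj L (e : Site 2))) F
    simp only [hinner, Finset.sum_const, h5, nsmul_eq_mul, Nat.cast_ofNat]
  have hB : ∑ x : TorusSite 2 L, ∑ _e : ↥(insert (0 : Site 2) unitSteps), F x =
      5 * ∑ x : TorusSite 2 L, F x := by
    simp only [Finset.sum_const, h5, nsmul_eq_mul, Nat.cast_ofNat, Finset.mul_sum]
  rw [Fintype.sum_prod_type]
  simp only [Fintype.sum_prod_type, Fin.sum_univ_two, Fin.isValue, if_true, one_ne_zero, if_false]
  rw [Finset.sum_congr rfl fun x _ => Finset.sum_add_distrib, Finset.sum_add_distrib, hA, hB]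
  ring

/-- `Σ_x ‖c_{x↓} ψ‖²` over torus sites (via `ofTorusSite`) equals `b ‖ψ‖²` on the sector `(a, b)`.
Lieb, PRL 62 (1989) 1201, eq. (2). [folklore] -/
theorem sum_torusSite_norm_sq_annihilation_down_of_isInSector {a b : ℕ}
    {ψ : Fock (Orb (FermionTorus 2 L))} (hψ : IsInSector a b ψ) :
    ∑ x : TorusSite 2 L, ‖(WithLp.toLp 2 (annihilation (orb (FermionTorus.ofTorusSite x) 1) *ᵥ ψ) :
        EuclideanSpace ℂ (Finset (Orb (FermionTorus 2 L))))‖ ^ 2 = (b : ℝ) * (star ψ ⬝ᵥ ψ).re := by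
  rw [← sum_norm_sq_annihilation_down_of_isInSector hψ]
  exact Equiv.sum_comp (FermionTorus.equivTorusSite (d := 2) (L := L)).symm
    (fun X => ‖(WithLp.toLp 2 (annihilation (orb X 1) *ᵥ ψ) :
      EuclideanSpace ℂ (Finset (Orb (FermionTorus 2 L))))‖ ^ 2)

/-- **No singlet pair amplitude without down electrons.** For every vector `ψ` of the sector
`(N↑, N↓) = (a, b)` of the fermionic torus and every form factor `g`:
`‖Δ_g ψ‖² ≤ 10 L² (Σ_e g(e)²) · b · ‖ψ‖²`. Proof: `Δ_g ψ = Σ_j w_j c_{(x,κ)} c_{(x+e,κ̄)} ψ` over the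
family `j = (x, e, κ)` (`PairFieldCarrier.pairField_mulVec_apply_eq_sum`), the triangle inequality,
`‖c_{(x,κ)} c_{(x+e,κ̄)} ψ‖ ≤ ‖c_{down} ψ‖`, Cauchy–Schwarz, `Σ_j |w_j|² = L² Σ_e g(e)²` and
`Σ_j ‖c_{down(j)} ψ‖² = 10 Σ_x ‖c_{x↓} ψ‖² = 10 b ‖ψ‖²`. Scalapino, Phys. Rep. 250 (1995) 329, §2;
Tasaki, Prog. Theor. Phys. 99 (1998) 489, p. 20 (an operator containing `c_{·↓}` is small on states
with few down electrons). [folklore] -/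
theorem norm_sq_pairField_mulVec_le_of_isInSector {a b : ℕ} {ψ : Fock (Orb (FermionTorus 2 L))}
    (hψ : IsInSector a b ψ) :
    ‖(WithLp.toLp 2 (pairField g L *ᵥ ψ) : EuclideanSpace ℂ (Finset (Orb (FermionTorus 2 L))))‖ ^ 2 ≤
      10 * (L : ℝ) ^ 2 * (∑ e ∈ insert (0 : Site 2) unitSteps, g e ^ 2) * b * (star ψ ⬝ᵥ ψ).re := by
  -- the family of elementary terms
  set w : TorusSite 2 L × ↥(insert (0 : Site 2) unitSteps) × Fin 2 → ℂ := fun j =>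
    if j.2.2 = 0 then (((g (j.2.1 : Site 2) / Real.sqrt 2 : ℝ) : ℂ))
      else -(((g (j.2.1 : Site 2) / Real.sqrt 2 : ℝ) : ℂ)) with hw
  set D : TorusSite 2 L × ↥(insert (0 : Site 2) unitSteps) × Fin 2 → ℝ := fun j =>
    ‖(WithLp.toLp 2 (annihilation (orb (FermionTorus.ofTorusSite
        (if j.2.2 = 0 then j.1 + Torus.proj L (j.2.1 : Site 2) else j.1)) 1) *ᵥ ψ) :
      EuclideanSpace ℂ (Finset (Orb (FermionTorus 2 L))))‖ with hD
  -- `Δ_g ψ = Σ_j w_j T_j ψ`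
  have hvec : pairField g L *ᵥ ψ = ∑ j : TorusSite 2 L × ↥(insert (0 : Site 2) unitSteps) × Fin 2,
      w j • ((annihilation (orb (FermionTorus.ofTorusSite j.1) j.2.2) *
        annihilation (orb (FermionTorus.ofTorusSite (j.1 + Torus.proj L (j.2.1 : Site 2))) (1 - j.2.2))) *ᵥ ψ) := by
    funext s
    rw [PairFieldCarrier.pairField_mulVec_apply_eq_sum, Finset.sum_apply]
    rfl
  -- triangle inequality and the contraction bound
  have htri : ‖(WithLp.toLp 2 (pairField g L *ᵥ ψ) : EuclideanSpace ℂ (Finset (Orb (FermionTorus 2 L))))‖ ≤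
      ∑ j, ‖w j‖ * D j := by
    rw [hvec, WithLp.toLp_sum]
    refine (norm_sum_le _ _).trans (Finset.sum_le_sum fun j _ => ?_)
    rw [WithLp.toLp_smul, norm_smul]
    refine mul_le_mul_of_nonneg_left ?_ (norm_nonneg _)
    have h := norm_toLp_pairTerm_mulVec_le L j.1 (j.1 + Torus.proj L (j.2.1 : Site 2)) j.2.2 ψ
    simp only [hD]
    convert h using 4
  -- Cauchy–Schwarz
  have hCS : (∑ j, ‖w j‖ * D j) ^ 2 ≤ (∑ j, ‖w j‖ ^ 2) * ∑ j, D j ^ 2 :=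
    Finset.sum_mul_sq_le_sq_mul_sq _ _ _
  have hwsum : ∑ j, ‖w j‖ ^ 2 = (L : ℝ) ^ 2 * ∑ e ∈ insert (0 : Site 2) unitSteps, g e ^ 2 :=
    PairFieldCarrier.sum_norm_sq_weight g L
  have hDsum : ∑ j, D j ^ 2 = 10 * ((b : ℝ) * (star ψ ⬝ᵥ ψ).re) := by
    rw [← sum_torusSite_norm_sq_annihilation_down_of_isInSector L hψ]
    simp only [hD]
    exact sum_family_downSiteWeight L (fun y => ‖(WithLp.toLp 2
      (annihilation (orb (FermionTorus.ofTorusSite y) 1) *ᵥ ψ) :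
        EuclideanSpace ℂ (Finset (Orb (FermionTorus 2 L))))‖ ^ 2)
  have h0 : 0 ≤ ∑ j, ‖w j‖ * D j := Finset.sum_nonneg fun j _ => mul_nonneg (norm_nonneg _) (norm_nonneg _)
  calc ‖(WithLp.toLp 2 (pairField g L *ᵥ ψ) : EuclideanSpace ℂ (Finset (Orb (FermionTorus 2 L))))‖ ^ 2
      ≤ (∑ j, ‖w j‖ * D j) ^ 2 := pow_le_pow_left₀ (norm_nonneg _) htri 2
    _ ≤ (∑ j, ‖w j‖ ^ 2) * ∑ j, D j ^ 2 := hCS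
    _ = 10 * (L : ℝ) ^ 2 * (∑ e ∈ insert (0 : Site 2) unitSteps, g e ^ 2) * b * (star ψ ⬝ᵥ ψ).re := by
      rw [hwsum, hDsum]; ring

/-- The `d_{x²-y²}` case (`Σ_e g_d(e)² = 4`): **`‖Δ_d ψ‖² ≤ 40 L² · N↓ · ‖ψ‖²`** on the sector
`(N↑, N↓) = (a, b)`. Scalapino, Phys. Rep. 250 (1995) 329, §2 eq. (2.3). [folklore] -/
theorem norm_sq_pairField_dWave_mulVec_le_of_isInSector {a b : ℕ} {ψ : Fock (Orb (FermionTorus 2 L))}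
    (hψ : IsInSector a b ψ) :
    ‖(WithLp.toLp 2 (pairField dWaveFormFactor L *ᵥ ψ) : EuclideanSpace ℂ (Finset (Orb (FermionTorus 2 L))))‖ ^ 2 ≤
      40 * (L : ℝ) ^ 2 * b * (star ψ ⬝ᵥ ψ).re := by
  have h := norm_sq_pairField_mulVec_le_of_isInSector dWaveFormFactor L hψ
  rw [PairFieldYang.sum_sq_dWaveFormFactor] at h
  linarith

end DownBound

/-! ### The `su(2)` ladder: a state of total spin `S` in the `S^z = 0` sector has the pair amplitude of a state with `N/2 - S` down electrons -/

section Ladder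

variable {Λ : Type*} [LinearOrder Λ] [Fintype Λ]

/-- `S² ≥ 0`: `Re ⟨ψ, S² ψ⟩ = ‖S^z ψ‖² + ½ ‖S⁻ ψ‖² + ½ ‖S⁺ ψ‖² ≥ 0`. Tasaki (2020) §2.4. [folklore] -/
theorem re_star_dotProduct_spinSq_mulVec_nonneg (ψ : Fock (Orb Λ)) :
    0 ≤ (star ψ ⬝ᵥ ((spinSq : Matrix (Finset (Orb Λ)) (Finset (Orb Λ)) ℂ) *ᵥ ψ)).re := by
  have hZ : (HubbardWave0.spinZ * HubbardWave0.spinZ : Matrix (Finset (Orb Λ)) (Finset (Orb Λ)) ℂ) =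
      HubbardWave0.spinZᴴ * HubbardWave0.spinZ := by rw [LiebTwo.spinZ_conjTranspose]
  have hP : (spinPlus * spinPlusᴴ : Matrix (Finset (Orb Λ)) (Finset (Orb Λ)) ℂ) =
      (spinPlusᴴ)ᴴ * spinPlusᴴ := by rw [conjTranspose_conjTranspose]
  have hre : ∀ v : Fock (Orb Λ), 0 ≤ (star v ⬝ᵥ v).re := fun v => by
    rw [← norm_toLp_sq_eq_re]; positivity
  rw [spinSq, add_mulVec, smul_mulVec, add_mulVec, dotProduct_add, dotProduct_smul,
    dotProduct_add, hZ, hP, LiebThm1.star_dotProduct_conjTranspose_mul_mulVec,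
    LiebThm1.star_dotProduct_conjTranspose_mul_mulVec,
    LiebThm1.star_dotProduct_conjTranspose_mul_mulVec, smul_eq_mul,
    show (1 / 2 : ℂ) = ((1 / 2 : ℝ) : ℂ) by norm_num, Complex.add_re, Complex.re_ofReal_mul,
    Complex.add_re]
  have h1 := hre (HubbardWave0.spinZ *ᵥ ψ)
  have h2 := hre (spinPlusᴴ *ᵥ ψ)
  have h3 := hre (spinPlus *ᵥ ψ)
  positivity

/-- On an `S²`-eigenvector the eigenvalue is `≥ 0`, or the vector vanishes. Tasaki (2020) §2.4. [folklore] -/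
theorem eq_zero_of_spinSq_mulVec_of_neg {ψ : Fock (Orb Λ)} {lam : ℝ}
    (hS : spinSq *ᵥ ψ = (lam : ℂ) • ψ) (hlam : lam < 0) : ψ = 0 := by
  have h := re_star_dotProduct_spinSq_mulVec_nonneg ψ
  rw [hS, dotProduct_smul, smul_eq_mul, Complex.re_ofReal_mul] at h
  have hnn : 0 ≤ (star ψ ⬝ᵥ ψ).re := by rw [← norm_toLp_sq_eq_re]; positivity
  have h0 : (star ψ ⬝ᵥ ψ).re = 0 := by nlinarith
  have h0' : ‖(WithLp.toLp 2 ψ : EuclideanSpace ℂ (Finset (Orb Λ)))‖ = 0 := by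
    have := norm_toLp_sq_eq_re ψ; rw [h0] at this; exact pow_eq_zero_iff two_ne_zero |>.1 this
  rw [norm_eq_zero] at h0'
  exact (WithLp.toLp_eq_zero 2).1 h0'

end Ladder

end Summit.HubbardSuperconductivity.HubbardSuperconductivity.Theorems.BirGroundStateAverageLRO.Negative
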